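import Summits.CriticalPhenomena.CardyFormulaZ2.Theorems.CardySusyWardParafermionFamiliesToSLESixSCRigidityA

/-!
# Schwarz–Christoffel rigidity on the strip, II: an isolated boundary singularity with
# non-negative traces on both sides is removable

Helper file for the crux `CardySusyWard.ParafermionFamiliesToSLESix` (stmt-CriticalPhenomena-10814),
line `exact-potential-schwarz-christoffel`, stub `stub_scRigidity` (pure complex analysis over Mathlib:
`Complex.differentiableOn_update_limUnder_of_isLittleO`, the tree's Schwarz reflection principle).

* `tendsto_of_nonneg_traces_near_breakpoint` — `Q` holomorphic on `B(b, r) ∩ S` (`S` the open strip)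
  with non-negative real limits from inside `S` at the real points `x ≠ b` near `b` and
  `‖Q w‖ ≤ K |w - b|^{β-1}`, `β > -1`: then `Q` has a non-negative real limit at `b` too.  The Schwarz
  reflection of `Q` is holomorphic on the punctured ball, `(w - b) Q` is `o(|w - b|^{-1})` hence extends
  holomorphically over `b` (Riemann), with value `0` (its real traces are `≥ 0` right of `b` and `≤ 0`
  left of `b`), and `Q → ((w - b) Q)′(b)`.  This is the breakpoint step of the rigidity theorem: at a
  corner of the polygon `h′/g′ = O(|w - b|^{β-1})` by the Cauchy estimates of part I.
-/

noncomputable section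

namespace Summit.CriticalPhenomena.CardyFormulaZ2.Theorems.ParafermionFamiliesToSLESix.SCRigidity

open Complex Set Filter Metric Topology
open scoped ComplexConjugate Real

/-- **Removable boundary singularity with non-negative traces on both sides.** Let `Q` be holomorphic
on `B(b, r) ∩ S` (`S` the open strip, `r ≤ 1`), with a non-negative real limit from inside `S` at every
real `x ≠ b` with `|x - b| < r`, and `‖Q w‖ ≤ K |w - b|^{β-1}` on `B(b, r) ∩ S` for some `β > -1`.  Then
`Q` has a non-negative real limit at `b` from inside `S`.  Proof: the Schwarz reflection `Q̃` of `Q` is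
holomorphic on the punctured ball; `(w - b) Q̃ = O(|w - b|^β) = o(|w - b|^{-1})` has a removable
singularity at `b` (Riemann), with value `0` there since its real traces are `≥ 0` on the right of `b`
and `≤ 0` on the left; hence `Q̃ = ((w - b) Q̃)/(w - b)` tends to the derivative at `b`, a limit of
non-negative reals. [folklore] -/
theorem tendsto_of_nonneg_traces_near_breakpoint :
    ∀ {Q : ℂ → ℂ} {b r K β : ℝ}, 0 < r → r ≤ 1 → -1 < β →
    DifferentiableOn ℂ Q (ball (b : ℂ) r ∩ {w : ℂ | 0 < w.im ∧ w.im < 1}) →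
    (∀ x : ℝ, x ≠ b → |x - b| < r →
      ∃ L : ℝ, 0 ≤ L ∧ Tendsto Q (𝓝[{w : ℂ | 0 < w.im ∧ w.im < 1}] (x : ℂ)) (𝓝 (L : ℂ))) →
    (∀ w ∈ ball (b : ℂ) r ∩ {w : ℂ | 0 < w.im ∧ w.im < 1}, ‖Q w‖ ≤ K * ‖w - b‖ ^ (β - 1)) →
    ∃ L : ℝ, 0 ≤ L ∧ Tendsto Q (𝓝[{w : ℂ | 0 < w.im ∧ w.im < 1}] (b : ℂ)) (𝓝 (L : ℂ)) := by
  intro Q b r K β hr hr1 hβ hQd hlim hK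
  set S : Set ℂ := {w : ℂ | 0 < w.im ∧ w.im < 1} with hS
  have hSo : IsOpen S := isOpen_strip
  have hclS : closure S = {w : ℂ | 0 ≤ w.im ∧ w.im ≤ 1} := closure_strip
  -- geometry of the ball
  have him : ∀ w ∈ ball (b : ℂ) r, |w.im| < r := by
    intro w hw
    rw [mem_ball, dist_eq_norm] at hw
    have := abs_im_le_norm (w - b)
    simp only [sub_im, ofReal_im, sub_zero] at this
    linarith
  have hre : ∀ w ∈ ball (b : ℂ) r, |w.re - b| < r := by
    intro w hw
    rw [mem_ball, dist_eq_norm] at hw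
    have := abs_re_le_norm (w - b)
    simp only [sub_re, ofReal_re] at this
    linarith
  have hballS : ∀ w ∈ ball (b : ℂ) r, 0 < w.im → w ∈ S := fun w hw h0 =>
    ⟨h0, by have := (abs_lt.mp (him w hw)).2; linarith⟩
  have hxcl : ∀ x : ℝ, (x : ℂ) ∈ closure S := fun x => by rw [hclS]; simp
  have hreal_ball : ∀ x : ℝ, |x - b| < r → (x : ℂ) ∈ ball (b : ℂ) r := by
    intro x hx
    rw [mem_ball, dist_eq_norm, ← ofReal_sub, norm_real, Real.norm_eq_abs]
    exact hx
  -- Step 1: `q := extendFrom S Q` agrees with `Q` on `B ∩ S`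
  set q : ℂ → ℂ := extendFrom S Q with hq
  have hQcont : ∀ w ∈ ball (b : ℂ) r ∩ S, Tendsto Q (𝓝[S] w) (𝓝 (Q w)) := by
    intro w hw
    have h1 : ContinuousAt Q w :=
      (hQd.differentiableAt ((isOpen_ball.inter hSo).mem_nhds hw)).continuousAt
    exact h1.tendsto.mono_left nhdsWithin_le_nhds
  have hqQ : ∀ w ∈ ball (b : ℂ) r ∩ S, q w = Q w := fun w hw =>
    extendFrom_eq (subset_closure hw.2) (hQcont w hw)
  -- Step 2: real points `x ≠ b` near `b`
  have hqx : ∀ x : ℝ, x ≠ b → |x - b| < r → (q x).im = 0 ∧ 0 ≤ (q x).re ∧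
      Tendsto Q (𝓝[S] (x : ℂ)) (𝓝 (q x)) := by
    intro x hx hxr
    obtain ⟨L, hL0, hL⟩ := hlim x hx hxr
    have : q x = L := extendFrom_eq (hxcl x) hL
    rw [this]
    exact ⟨by simp, by simpa using hL0, hL⟩
  have hofReal : ∀ z : ℂ, z.im = 0 → z = ((z.re : ℝ) : ℂ) := fun z hz =>
    Complex.ext (by simp) (by simp [hz])
  -- Step 3: continuity of `q` on the closed upper half of the punctured ball `P`
  set P : Set ℂ := ball (b : ℂ) r \ {(b : ℂ)} with hP
  have hPo : IsOpen P := isOpen_ball.sdiff isClosed_singleton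
  have hPre : ∀ z ∈ P, z.im = 0 → z.re ≠ b ∧ |z.re - b| < r := by
    rintro z ⟨hz, hzb⟩ hz0
    refine ⟨fun h => hzb ?_, hre z hz⟩
    rw [mem_singleton_iff, hofReal z hz0, h]
  have hqc : ContinuousOn q (P ∩ {z : ℂ | 0 ≤ z.im}) := by
    apply continuousOn_extendFrom
    · rintro z ⟨⟨hz, -⟩, hz0⟩
      rw [hclS]
      exact ⟨hz0, by have := (abs_lt.mp (him z hz)).2; linarith⟩
    · rintro z ⟨hzP, hz0⟩
      rcases (show 0 ≤ z.im from hz0).lt_or_eq with h0 | h0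
      · exact ⟨Q z, hQcont z ⟨hzP.1, hballS z hzP.1 h0⟩⟩
      · obtain ⟨hzb', hzr⟩ := hPre z hzP h0.symm
        obtain ⟨-, -, hL⟩ := hqx z.re hzb' hzr
        rw [hofReal z h0.symm]
        exact ⟨_, hL⟩
  -- Step 4: the Schwarz reflection `R` of `q` is holomorphic on `P`
  have hsymm : ∀ z ∈ P, conj z ∈ P := by
    rintro z ⟨hz, hzb⟩
    refine ⟨?_, fun h => hzb ?_⟩
    · rw [mem_ball] at hz ⊢
      rwa [← conj_ofReal, dist_conj_conj]
    · rw [mem_singleton_iff] at h ⊢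
      rw [← conj_conj z, h, conj_ofReal]
  have hsubS : P ∩ {z : ℂ | 0 < z.im} ⊆ ball (b : ℂ) r ∩ S :=
    fun z hz => ⟨hz.1.1, hballS z hz.1.1 hz.2⟩
  have hqd : DifferentiableOn ℂ q (P ∩ {z : ℂ | 0 < z.im}) :=
    (hQd.mono hsubS).congr (fun z hz => hqQ z (hsubS hz))
  have hqreal : ∀ z ∈ P, z.im = 0 → conj (q z) = q z := by
    intro z hzP hz0
    obtain ⟨hzb', hzr⟩ := hPre z hzP hz0
    obtain ⟨hi, -, -⟩ := hqx z.re hzb' hzr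
    rw [conj_eq_iff_im, hofReal z hz0, hi]
  set R : ℂ → ℂ := schwarzReflection q with hRdef
  have hRd : DifferentiableOn ℂ R P := differentiableOn_schwarzReflection hPo hsymm hqc hqd hqreal
  -- Step 5: growth of `R` on `P`
  set K' : ℝ := max K 1 with hK'
  have hK'0 : 0 < K' := lt_of_lt_of_le one_pos (le_max_right _ _)
  have hKS : ∀ w ∈ ball (b : ℂ) r ∩ S, ‖Q w‖ ≤ K' * ‖w - b‖ ^ (β - 1) := fun w hw =>
    (hK w hw).trans (mul_le_mul_of_nonneg_right (le_max_left _ _) (Real.rpow_nonneg (norm_nonneg _) _))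
  haveI hneBot : ∀ x : ℝ, (𝓝[S] (x : ℂ)).NeBot := nhdsWithin_strip_neBot
  have hRbound : ∀ z ∈ P, ‖R z‖ ≤ K' * ‖z - b‖ ^ (β - 1) := by
    intro z hzP
    rcases lt_trichotomy z.im 0 with h0 | h0 | h0
    · -- lower half: `R z = conj (Q (conj z))`
      have hcz : conj z ∈ ball (b : ℂ) r ∩ S :=
        ⟨(hsymm z hzP).1, hballS _ (hsymm z hzP).1 (by rw [conj_im]; linarith)⟩
      rw [hRdef, schwarzReflection_of_neg h0, norm_conj, hqQ _ hcz]
      have hn : ‖conj z - (b : ℂ)‖ = ‖z - b‖ := by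
        rw [← norm_conj (z - b), map_sub, conj_ofReal]
      simpa [hn] using hKS _ hcz
    · -- real axis: pass to the limit in the bound
      obtain ⟨hzb', hzr⟩ := hPre z hzP h0
      obtain ⟨-, -, hL⟩ := hqx z.re hzb' hzr
      rw [hRdef, schwarzReflection_of_nonneg h0.symm.le]
      have hz' := hofReal z h0
      have hzne : ‖z - (b : ℂ)‖ ≠ 0 := by
        rw [norm_ne_zero_iff, sub_ne_zero]
        exact fun h => hzP.2 (mem_singleton_iff.mpr h)
      have hgc : ContinuousAt (fun w : ℂ => K' * ‖w - (b : ℂ)‖ ^ (β - 1)) z :=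
        continuousAt_const.mul ((continuous_norm.comp (continuous_sub_right _)).continuousAt.rpow_const
          (Or.inl hzne))
      have hball_mem : ball (b : ℂ) r ∈ 𝓝 z := isOpen_ball.mem_nhds hzP.1
      rw [hz'] at hL hgc hball_mem ⊢
      refine le_of_tendsto_of_tendsto hL.norm (hgc.tendsto.mono_left nhdsWithin_le_nhds) ?_
      filter_upwards [mem_nhdsWithin_of_mem_nhds hball_mem, self_mem_nhdsWithin] with w h1 h2
      exact hKS w ⟨h1, h2⟩
    · -- upper half
      have hz : z ∈ ball (b : ℂ) r ∩ S := ⟨hzP.1, hballS z hzP.1 h0⟩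
      rw [hRdef, schwarzReflection_of_nonneg h0.le, hqQ z hz]
      exact hKS z hz
  -- Step 6: `G := (w - b) R` has a removable singularity at `b`
  set G : ℂ → ℂ := fun z => (z - b) * R z with hGdef
  have hGd : DifferentiableOn ℂ G (ball (b : ℂ) r \ {(b : ℂ)}) :=
    ((differentiableOn_id.sub (differentiableOn_const _)).mul hRd)
  have hGb : G b = 0 := by simp [hGdef]
  have hGbound : ∀ z ∈ P, ‖G z‖ ≤ K' * ‖z - b‖ ^ β := by
    intro z hzP
    have hzne : ‖z - (b : ℂ)‖ ≠ 0 := by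
      rw [norm_ne_zero_iff, sub_ne_zero]
      exact fun h => hzP.2 (mem_singleton_iff.mpr h)
    have h1 := hRbound z hzP
    rw [Real.rpow_sub_one hzne] at h1
    calc ‖G z‖ = ‖z - b‖ * ‖R z‖ := by rw [hGdef]; exact norm_mul _ _
      _ ≤ ‖z - b‖ * (K' * (‖z - ↑b‖ ^ β / ‖z - ↑b‖)) :=
          mul_le_mul_of_nonneg_left h1 (norm_nonneg _)
      _ = K' * ‖z - b‖ ^ β := by field_simp
  have hlittle : (fun z => G z - G b) =o[𝓝[≠] (b : ℂ)] fun z => (z - b)⁻¹ := by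
    simp only [hGb, sub_zero]
    refine Asymptotics.IsLittleO.of_bound fun ε hε => ?_
    set δ : ℝ := (ε / K') ^ (β + 1)⁻¹ with hδ
    have hδ0 : 0 < δ := Real.rpow_pos_of_pos (div_pos hε hK'0) _
    have hmem : ball (b : ℂ) (min r δ) ∈ 𝓝 (b : ℂ) := ball_mem_nhds _ (lt_min hr hδ0)
    filter_upwards [mem_nhdsWithin_of_mem_nhds hmem, self_mem_nhdsWithin] with z hz hzb
    have hzr : z ∈ ball (b : ℂ) r := ball_subset_ball (min_le_left _ _) hz
    have hzδ : ‖z - b‖ < δ := by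
      have := ball_subset_ball (min_le_right r δ) hz
      rwa [mem_ball, dist_eq_norm] at this
    have hzP : z ∈ P := ⟨hzr, hzb⟩
    have hzpos : 0 < ‖z - (b : ℂ)‖ := by
      rw [norm_pos_iff, sub_ne_zero]
      exact fun h => hzb (mem_singleton_iff.mpr h)
    have hpow : ‖z - (b : ℂ)‖ ^ (β + 1) ≤ ε / K' := by
      calc ‖z - (b : ℂ)‖ ^ (β + 1) ≤ δ ^ (β + 1) :=
            Real.rpow_le_rpow (norm_nonneg _) hzδ.le (by linarith)
        _ = ε / K' := by rw [hδ, Real.rpow_inv_rpow (div_pos hε hK'0).le (by linarith)]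
    rw [norm_inv]
    calc ‖G z‖ ≤ K' * ‖z - b‖ ^ β := hGbound z hzP
      _ = K' * ‖z - b‖ ^ (β + 1) * ‖z - (b : ℂ)‖⁻¹ := by
          rw [Real.rpow_add_one hzpos.ne' β]; field_simp
      _ ≤ K' * (ε / K') * ‖z - (b : ℂ)‖⁻¹ := by gcongr
      _ = ε * ‖z - (b : ℂ)‖⁻¹ := by field_simp
  have hGt := differentiableOn_update_limUnder_of_isLittleO (ball_mem_nhds _ hr) hGd hlittle
  set Gt : ℂ → ℂ := Function.update G (b : ℂ) (limUnder (𝓝[≠] (b : ℂ)) G) with hGtdef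
  have hGt_ne : ∀ z : ℂ, z ≠ b → Gt z = G z := fun z hz => Function.update_of_ne hz _ _
  have hGt_at : DifferentiableAt ℂ Gt b := hGt.differentiableAt (ball_mem_nhds _ hr)
  -- Step 7: `Gt b = 0` (traces `≥ 0` on the right, `≤ 0` on the left)
  have hofR : Tendsto ((↑) : ℝ → ℂ) (𝓝 b) (𝓝 (b : ℂ)) := continuous_ofReal.tendsto b
  have hGt_real : ∀ t : ℝ, t ≠ b → |t - b| < r → Gt t = ((t - b : ℝ) : ℂ) * q t := by
    intro t ht htr
    have htb : (t : ℂ) ≠ b := fun h => ht (by exact_mod_cast h)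
    rw [hGt_ne _ htb, hGdef]
    simp only [hRdef, schwarzReflection_ofReal, ofReal_sub]
  have hClP : IsClosed {z : ℂ | z.im = 0 ∧ 0 ≤ z.re} :=
    (isClosed_eq continuous_im continuous_const).inter (isClosed_le continuous_const continuous_re)
  have hClN : IsClosed {z : ℂ | z.im = 0 ∧ z.re ≤ 0} :=
    (isClosed_eq continuous_im continuous_const).inter (isClosed_le continuous_re continuous_const)
  have hGtb : Gt b = 0 := by
    have hT : Tendsto (fun t : ℝ => Gt t) (𝓝 b) (𝓝 (Gt b)) := hGt_at.continuousAt.tendsto.comp hofR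
    have hTr : Tendsto (fun t : ℝ => Gt t) (𝓝[>] b) (𝓝 (Gt b)) := hT.mono_left nhdsWithin_le_nhds
    have hTl : Tendsto (fun t : ℝ => Gt t) (𝓝[<] b) (𝓝 (Gt b)) := hT.mono_left nhdsWithin_le_nhds
    have hPos : Gt b ∈ {z : ℂ | z.im = 0 ∧ 0 ≤ z.re} := by
      refine hClP.mem_of_tendsto hTr ?_
      filter_upwards [Ioo_mem_nhdsGT (show b < b + r by linarith)] with t ht
      have htb : t ≠ b := ne_of_gt ht.1
      have htr : |t - b| < r := by rw [abs_lt]; constructor <;> linarith [ht.1, ht.2]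
      obtain ⟨hi, hr0, -⟩ := hqx t htb htr
      rw [hGt_real t htb htr]
      refine ⟨by simp [hi], ?_⟩
      simp only [re_ofReal_mul]
      exact mul_nonneg (by linarith [ht.1]) hr0
    have hNeg : Gt b ∈ {z : ℂ | z.im = 0 ∧ z.re ≤ 0} := by
      refine hClN.mem_of_tendsto hTl ?_
      filter_upwards [Ioo_mem_nhdsLT (show b - r < b by linarith)] with t ht
      have htb : t ≠ b := ne_of_lt ht.2
      have htr : |t - b| < r := by rw [abs_lt]; constructor <;> linarith [ht.1, ht.2]
      obtain ⟨hi, hr0, -⟩ := hqx t htb htr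
      rw [hGt_real t htb htr]
      refine ⟨by simp [hi], ?_⟩
      simp only [re_ofReal_mul]
      exact mul_nonpos_of_nonpos_of_nonneg (by linarith [ht.2]) hr0
    exact Complex.ext (le_antisymm hNeg.2 hPos.2) (by simpa using hPos.1)
  -- Step 8: `R → Gt′(b)` on the punctured ball, hence `Q → Gt′(b)` from inside `S`
  set D : ℂ := deriv Gt b with hD
  have hslope : Tendsto (slope Gt (b : ℂ)) (𝓝[≠] (b : ℂ)) (𝓝 D) :=
    hasDerivAt_iff_tendsto_slope.mp hGt_at.hasDerivAt
  have hRt : Tendsto R (𝓝[≠] (b : ℂ)) (𝓝 D) := by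
    refine hslope.congr' ?_
    filter_upwards [self_mem_nhdsWithin] with z hz
    have hz' : z - (b : ℂ) ≠ 0 := sub_ne_zero.mpr hz
    rw [slope_def_field, hGtb, sub_zero, hGt_ne z hz, hGdef]
    field_simp
  have hSsub : S ⊆ {(b : ℂ)}ᶜ := by
    intro z hz h
    rw [mem_singleton_iff] at h
    rw [h] at hz
    simp [hS] at hz
  have hQt : Tendsto Q (𝓝[S] (b : ℂ)) (𝓝 D) := by
    refine (hRt.mono_left (nhdsWithin_mono _ hSsub)).congr' ?_
    filter_upwards [mem_nhdsWithin_of_mem_nhds (ball_mem_nhds (b : ℂ) hr), self_mem_nhdsWithin]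
      with z hz hzS
    rw [hRdef, schwarzReflection_of_nonneg (le_of_lt hzS.1), hqQ z ⟨hz, hzS⟩]
  -- `D` is a limit of the non-negative reals `q t`, `t → b⁺`
  have hDmem : D ∈ {z : ℂ | z.im = 0 ∧ 0 ≤ z.re} := by
    have hof0 : Tendsto ((↑) : ℝ → ℂ) (𝓝[>] b) (𝓝 (b : ℂ)) := hofR.mono_left nhdsWithin_le_nhds
    have hof' : Tendsto ((↑) : ℝ → ℂ) (𝓝[>] b) (𝓝[≠] (b : ℂ)) := by
      refine tendsto_nhdsWithin_iff.mpr ⟨hof0, ?_⟩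
      filter_upwards [self_mem_nhdsWithin] with t ht
      exact fun h => (ne_of_gt ht) (by exact_mod_cast (mem_singleton_iff.mp h))
    refine hClP.mem_of_tendsto (hRt.comp hof') ?_
    filter_upwards [Ioo_mem_nhdsGT (show b < b + r by linarith)] with t ht
    have htb : t ≠ b := ne_of_gt ht.1
    have htr : |t - b| < r := by rw [abs_lt]; constructor <;> linarith [ht.1, ht.2]
    obtain ⟨hi, hr0, -⟩ := hqx t htb htr
    simp only [Function.comp, hRdef, schwarzReflection_ofReal]
    exact ⟨hi, hr0⟩
  refine ⟨D.re, hDmem.2, ?_⟩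
  have : ((D.re : ℝ) : ℂ) = D := (hofReal D hDmem.1).symm
  rw [this]
  exact hQt

end Summit.CriticalPhenomena.CardyFormulaZ2.Theorems.ParafermionFamiliesToSLESix.SCRigidity
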